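/-
Copyright (c) 2026 the pub-hodgecm-mathlib formalisation cell (harness21).  Prover seat hodgecm-mathlib-F0P3a-p01 (g23), 2026-09-03.  E1 row 48 «(SS-O) ELLIPTIC UNFOLDING ASSEMBLY»,
DATUM FILE (E1 keeper ∕ dealer F0P3a-p03 (g29) 02:31:24Z «datum SECOND, --as helper»; (g30) 02:50:02Z); census `F0/P3a/F0P3a-p01/g23/r48/CENSUS-R48-SSO-elliptic-unfolding.v1.F0P3ap01g23.md`.
-/
import Summits.HodgeConjecture.HodgeConjecture.Theorems.F0P3cStCharTSCharacterEllipticUniform   -- ★ 41g-H (LH6-p04 g11): the (G3)-EXPLICIT tree letters at `Gqs L v` (`ha`, `hU`, `hUo`…), §2 lemmas, and the (SS-K) head whose currency this file matches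
import Literature.NumberTheory.Automorphic.SmoothCharacterEPFunctionOrbitalSum                   -- ★ R48-gen FILE 2 (this seat) p853346: one-orbit unfolding, additivity, EP-sum head
import Literature.NumberTheory.Automorphic.UnitOrbitalIntegralFixedPointsVolume                 -- ★ the `G_v` socket letters: `isRegularElt_val_conj`, `isClosed_conjClass_local_of_isRegularElt`
import Literature.NumberTheory.Automorphic.UnitaryLatticeTreeEulerRelation                      -- ★ E4 EULER-G (LH7): `forall_flag_exists_unitary` (one edge orbit)
import Literature.NumberTheory.Automorphic.UnitaryLatticeTreeTypeTwoTransitive                  -- ★ 39β: `exists_mapGL_N₁_eq_of_isVertexLattice_two` (one type-2 orbit), `v_det`∕types via Apartment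
import Literature.NumberTheory.Automorphic.UnitaryLatticeTreeSelfDualTransitiveOfTrace          -- ★ `exists_unitary_mapGL_stdLattice_eq_of_isSelfDualLattice_of_trace` (one self-dual orbit)
import Literature.Combinatorics.SimpleGraph.GraphAutomorphismsOneForms                                 -- ★ `BakerNorine.coe_mapEdgeSet`, `mapEdgeSet_mul`, `mapEdgeSet_one` (edge action bookkeeping)
import HarnessLib

/-!
# F0 · P3c · line LH6 «StCharTS» — E1 row 48 DATUM, FILE 1 of 2 «THE THREE FACET ORBITS»: the orbital integral of ONE `K`-type function on `G_v = U(Φ₃)(L⁺_v)` at a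
# regular elliptic class, unfolded over the `γ`-fixed vertices of one type ∕ the `γ`-fixed edges of the Bruhat–Tits tree, in ★ 41g-H's letters
# ([SchneiderStuhler1997 §III.4], [Kottwitz1988 §2], [Rogawski1990 §4.9, §12.5])

Cell `pub/hodgecm-mathlib` (D-0151), crux H413 = `stmt-HodgeConjecture-24833`; lane `--kind proof --supports stmt-HodgeConjecture-24833 --as helper` (THEOREMS ONLY: no definition ∕
instance ∕ notation ∕ named fact ∕ `sorry`; count-neutral: closes no node).  Namespace `Summit.HodgeConjecture.HodgeConjecture.Cruxes.H413.F0P3cStCharTSEPFunctionOrbitalOrbits`.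
HONEST LABEL: (R-SS) NOT chartered; E1 = PRINT until the keeper's charter test; h413 OPEN; HC_CM is proved only modulo the printed citations (2 remaining named inputs hLiu418 =
stmt-HodgeConjecture-24832, h413 = stmt-HodgeConjecture-24833) until rung 0 closes; nothing printed is asserted here.

LETTERS = ★ 41g-H's: `(w hw ϖ hd eA)` the (G3)-EXPLICIT one-place model, `{a} ha` the action hom `G_v →* Aut(tree)`, `(τ) hτ` an invariant orientation (`tail < head`), `{e U} hU` the
unitary level family at level `ϖ^(e+1)` with `hUo hUc hEo hEc`, `hfin`∕`hfinE` the finite `γ`-fixed vertex∕edge sets; PLUS `(νQv) (hcanQ)` ((G3)-EXPLICIT measure letters), `hreg`∕`hell`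
(regular elliptic `γ`), a base edge `d₁` (its head `o₀ := τ.head d₁` is self-dual, its tail `o₂ := τ.tail d₁` of type two — ★ `type_of_lt_three`), the three stabilisers `P₀ P₂ P₁`
(hypothesis-style `hP₀ hP₂ hP₁`), and three `K`-type pieces `fᵢ = 𝟙_{Pᵢ} · χ_{τᵢ}(·⁻¹)` in ★ row 42's letters `hfPᵢ`∕`hf0ᵢ` with `τᵢ = ρ|_{Pᵢ}` on `V^{Uᵢ}` (`hτρᵢ`) trivial on `Uᵢ`
(`hτᵢ`, membership form), `U₀ = U o₀`, `U₂ = U o₂`, `U₁ = U (τ.head d₁) ⊔ U (τ.tail d₁)`.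

* §1 (generic, tiny) `mem_normalizer_sup_of_mem` (`g ∈ N(A) → g ∈ N(B) → g ∈ N(A ⊔ B)`) and `epSum_arith` (the three EP weights cancel the three volumes, in `ℂ`).
* §2 THE THREE FACET ORBITS at the datum: `isCompact_setOf_actionHom_apply_eq` (vertex stabilisers are compact), transitivity suppliers
  `exists_actionHom_apply_eq_of_isVertexLattice_zero` ∕ `_two` (★ self-dual ∕ type-two transitivity moved along `eA`), `exists_mapEdgeSet_eq` (ONE edge orbit, ★ E4
  `forall_flag_exists_unitary`), `mapEdgeSet_eq_iff` (no inversion: an edge is fixed iff its ends are), and the per-orbit unfoldings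
  **`classOrbitalIntegral_kType_vertex_eq`** (a vertex orbit of type `k`, transitivity hypothesis-style `htrans`):
  `Φ^{can}(γ, 𝟙_P χ_{τ₀}(·⁻¹)) = ν(P) · Σᶠ_{x ∈ X^γ⁰ of type k} Θ_{U_x}(γ⁻¹)`, and **`classOrbitalIntegral_kType_edge_eq`** (the edge orbit):
  `Φ^{can}(γ, 𝟙_{P₁} χ_{τ₁}(·⁻¹)) = ν(P₁) · Σᶠ_{d ∈ X^γ¹} Θ_{U_d}(γ⁻¹)` — ★ R48-gen FILE 2 §1 each; closed class ★ `isClosed_conjClass_local_of_isRegularElt`, `hQ` ★ `isRegularElt_val_conj`.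
FILE 2 (`F0P3cStCharTSEPFunctionOrbitalElliptic`) assembles the Euler–Poincaré sum `(ν P₀)⁻¹ f₀ + (ν P₂)⁻¹ f₂ − (ν P₁)⁻¹ f₁` into ★ 41g-H's currency.

## References
* [SchneiderStuhler1997] P. Schneider, U. Stuhler, *Representation theory and sheaves on the Bruhat–Tits building*, Publ. Math. IHÉS 85 (1997): §III.4.
* [Kottwitz1988] R. E. Kottwitz, *Tamagawa numbers*, Ann. of Math. 127 (1988): §2.
* [Rogawski1990] J. D. Rogawski, *Automorphic Representations of Unitary Groups in Three Variables* (1990): §4.9 p. 54, §12.5 pp. 182–187.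
* [BruhatTits1972] F. Bruhat, J. Tits, *Groupes réductifs sur un corps local* I, Publ. Math. IHÉS 41 (1972): §10.
-/

set_option autoImplicit false

set_option linter.dupNamespace false

noncomputable section

open NumberField IsDedekindDomain MeasureTheory Measure
open scoped Pointwise Valued WithZero Matrix MatrixGroups
open Literature.NumberTheory.Rogawski1990 Literature.NumberTheory.Rogawski1990.Ch12Sec5
open Literature.NumberTheory.Automorphic Literature.NumberTheory.Automorphic.UnitaryGroup Literature.NumberTheory.Automorphic.UnitaryLatticeTree
open Literature.NumberTheory.Automorphic.HermitianLattice Literature.NumberTheory.GaloisRepresentations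
open Literature.Combinatorics.SimpleGraph Literature.Combinatorics.SimpleGraph.OrientedIncidence

namespace Summit.HodgeConjecture.HodgeConjecture.Cruxes.H413.F0P3cStCharTSEPFunctionOrbitalOrbits

open Summit.HodgeConjecture.HodgeConjecture.Cruxes.H413
open Summit.HodgeConjecture.HodgeConjecture.Cruxes.H413.F0P3cStCharTSCharacterEllipticUniform

/-! ## §1 Two generic lemmas -/

/-- `N(A) ⊓ N(B) ≤ N(A ⊔ B)`: an element normalising two subgroups normalises their join. [cite: SchneiderStuhler1997, Ch. I §2 (U3)] -/
theorem mem_normalizer_sup_of_mem {Γ : Type*} [Group Γ] {A B : Subgroup Γ} {g : Γ}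
    (hA : g ∈ Subgroup.normalizer (A : Set Γ)) (hB : g ∈ Subgroup.normalizer (B : Set Γ)) : g ∈ Subgroup.normalizer ((A ⊔ B : Subgroup Γ) : Set Γ) := by
  have hmap : ∀ {C : Subgroup Γ}, g ∈ Subgroup.normalizer (C : Set Γ) → C.map (MulAut.conj g).toMonoidHom = C := by
    intro C hC
    ext x
    rw [Subgroup.mem_map_equiv, MulAut.conj_symm_apply, Subgroup.mem_normalizer_iff.1 hC (g⁻¹ * x * g), ← mul_assoc, ← mul_assoc, mul_inv_cancel, one_mul,
      mul_inv_cancel_right]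
  have hsup : (A ⊔ B).map (MulAut.conj g).toMonoidHom = A ⊔ B := by rw [Subgroup.map_sup, hmap hA, hmap hB]
  rw [Subgroup.mem_normalizer_iff]
  intro x
  constructor
  · intro hx
    have h : (MulAut.conj g) x ∈ (A ⊔ B).map (MulAut.conj g).toMonoidHom := Subgroup.mem_map_of_mem _ hx
    rwa [hsup, MulAut.conj_apply] at h
  · intro hx
    rw [← hsup, Subgroup.mem_map_equiv, MulAut.conj_symm_apply, ← mul_assoc, ← mul_assoc, inv_mul_cancel, one_mul, inv_mul_cancel_right] at hx
    exact hx

/-- Bookkeeping in `ℂ`: the three Euler–Poincaré weights cancel the three volumes. [cite: Kottwitz1988, §2] -/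
theorem epSum_arith {I₀ I₂ I₁ A B C SV SE : ℂ} {r₀ r₂ r₁ : ℝ} (hr₀ : (r₀ : ℂ) ≠ 0) (hr₂ : (r₂ : ℂ) ≠ 0) (hr₁ : (r₁ : ℂ) ≠ 0)
    (h₀ : I₀ = r₀ • A) (h₂ : I₂ = r₂ • B) (h₁ : I₁ = r₁ • C) (hV : A + B = SV) (hE : C = SE) :
    ((r₀ : ℂ))⁻¹ * I₀ + ((r₂ : ℂ))⁻¹ * I₂ + -((r₁ : ℂ))⁻¹ * I₁ = SV - SE := by
  subst h₀ h₂ h₁ hV hE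
  rw [Complex.real_smul, Complex.real_smul, Complex.real_smul, ← mul_assoc, ← mul_assoc, ← mul_assoc, inv_mul_cancel₀ hr₀, inv_mul_cancel₀ hr₂, neg_mul,
    inv_mul_cancel₀ hr₁, one_mul, one_mul, neg_one_mul, sub_eq_add_neg]

/-! ## §2 The three facet orbits at the datum -/

section Head

variable (L : Type) [Field L] [NumberField L] [IsCMField L] (v : HeightOneSpectrum (𝓞 ↥(maximalRealSubfield L)))


/-- **Vertex stabilisers are compact** in `G_v` (★ FILE P `isCompact_setOf_latticeGraphIso_apply_eq` pulled back along `eA`). [cite: BruhatTits1972, §10] -/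
theorem isCompact_setOf_actionHom_apply_eq
    (w : PlacesOver L v) (hw : IsCMField.complexConj L • w.1 = w.1) {ϖ : (w.1.adicCompletion L)} (eA : (Gqs L v) ≃ₜ* ↥(unitaryGroupOfForm (galAdicCompletionMap (L := L) (IsCMField.complexConj L) hw) ((StdForm.antidiagonal 3).over (w.1.adicCompletion L))))
    {a : (Gqs L v) →* ((latticeGraph (galAdicCompletionMap (L := L) (IsCMField.complexConj L) hw) ϖ ((StdForm.antidiagonal 3).over (w.1.adicCompletion L))) ≃g (latticeGraph (galAdicCompletionMap (L := L) (IsCMField.complexConj L) hw) ϖ ((StdForm.antidiagonal 3).over (w.1.adicCompletion L))))} (ha : ∀ g, a g = latticeGraphIso (galAdicCompletionMap (L := L) (IsCMField.complexConj L) hw) ϖ ((StdForm.antidiagonal 3).over (w.1.adicCompletion L)) (eA g))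
    (o : {M : Submodule 𝒪[(w.1.adicCompletion L)] (Fin 3 → (w.1.adicCompletion L)) // IsVertex (galAdicCompletionMap (L := L) (IsCMField.complexConj L) hw) ϖ ((StdForm.antidiagonal 3).over (w.1.adicCompletion L)) M}) : IsCompact {g : (Gqs L v) | a g o = o} := by
  haveI := compactSpace_integer_adicCompletion L w.1
  have hpre : {g : (Gqs L v) | a g o = o} = eA ⁻¹' {u : ↥(unitaryGroupOfForm (galAdicCompletionMap (L := L) (IsCMField.complexConj L) hw) ((StdForm.antidiagonal 3).over (w.1.adicCompletion L))) | latticeGraphIso (galAdicCompletionMap (L := L) (IsCMField.complexConj L) hw) ϖ ((StdForm.antidiagonal 3).over (w.1.adicCompletion L)) u o = o} := by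
    ext g; simp only [Set.mem_setOf_eq, Set.mem_preimage, ha]
  rw [hpre]
  exact eA.toHomeomorph.isCompact_preimage.2
    (isCompact_setOf_latticeGraphIso_apply_eq (galAdicCompletionMap (L := L) (IsCMField.complexConj L) hw) ϖ ((StdForm.antidiagonal 3).over (w.1.adicCompletion L)) (continuous_galAdicCompletionMap L (IsCMField.complexConj L) hw) o)

/-- **ONE ORBIT OF SELF-DUAL VERTICES**: `G_v` is transitive on the self-dual vertices (★ `exists_unitary_mapGL_stdLattice_eq_of_isSelfDualLattice_of_trace` along `eA`).
[cite: BruhatTits1972, §10] [cite: SchneiderStuhler1997, §III.4] -/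
theorem exists_actionHom_apply_eq_of_isVertexLattice_zero
    (w : PlacesOver L v) (hw : IsCMField.complexConj L • w.1 = w.1) {ϖ : (w.1.adicCompletion L)} (hd : UnramifiedLocalConjDatum (galAdicCompletionMap (L := L) (IsCMField.complexConj L) hw) ϖ)
    (eA : (Gqs L v) ≃ₜ* ↥(unitaryGroupOfForm (galAdicCompletionMap (L := L) (IsCMField.complexConj L) hw) ((StdForm.antidiagonal 3).over (w.1.adicCompletion L))))
    {a : (Gqs L v) →* ((latticeGraph (galAdicCompletionMap (L := L) (IsCMField.complexConj L) hw) ϖ ((StdForm.antidiagonal 3).over (w.1.adicCompletion L))) ≃g (latticeGraph (galAdicCompletionMap (L := L) (IsCMField.complexConj L) hw) ϖ ((StdForm.antidiagonal 3).over (w.1.adicCompletion L))))} (ha : ∀ g, a g = latticeGraphIso (galAdicCompletionMap (L := L) (IsCMField.complexConj L) hw) ϖ ((StdForm.antidiagonal 3).over (w.1.adicCompletion L)) (eA g))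
    (x y : {M : Submodule 𝒪[(w.1.adicCompletion L)] (Fin 3 → (w.1.adicCompletion L)) // IsVertex (galAdicCompletionMap (L := L) (IsCMField.complexConj L) hw) ϖ ((StdForm.antidiagonal 3).over (w.1.adicCompletion L)) M}) (hx : IsVertexLattice (galAdicCompletionMap (L := L) (IsCMField.complexConj L) hw) ϖ ((StdForm.antidiagonal 3).over (w.1.adicCompletion L)) 0 x.1) (hy : IsVertexLattice (galAdicCompletionMap (L := L) (IsCMField.complexConj L) hw) ϖ ((StdForm.antidiagonal 3).over (w.1.adicCompletion L)) 0 y.1) : ∃ g : (Gqs L v), a g x = y := by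
  obtain ⟨u, hu⟩ := exists_unitary_mapGL_stdLattice_eq_of_isSelfDualLattice_of_trace hd.σσ hd.vσ hd.vϖ hd.trace hy
  obtain ⟨u₀, hu₀⟩ := exists_unitary_mapGL_stdLattice_eq_of_isSelfDualLattice_of_trace hd.σσ hd.vσ hd.vϖ hd.trace hx
  refine ⟨eA.symm (u * u₀⁻¹), Subtype.ext ?_⟩
  rw [ha, ContinuousMulEquiv.apply_symm_apply, latticeGraphIso_apply_val, ← hu₀, Subgroup.coe_mul, Subgroup.coe_inv, ← mapGL_mul,
    inv_mul_cancel_right, hu]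

/-- **ONE ORBIT OF TYPE-TWO VERTICES**: `G_v` is transitive on the type-two vertices (★ `exists_mapGL_N₁_eq_of_isVertexLattice_two` along `eA`).
[cite: BruhatTits1972, §10] [cite: SchneiderStuhler1997, §III.4] -/
theorem exists_actionHom_apply_eq_of_isVertexLattice_two
    (w : PlacesOver L v) (hw : IsCMField.complexConj L • w.1 = w.1) {ϖ : (w.1.adicCompletion L)} (hd : UnramifiedLocalConjDatum (galAdicCompletionMap (L := L) (IsCMField.complexConj L) hw) ϖ)
    (eA : (Gqs L v) ≃ₜ* ↥(unitaryGroupOfForm (galAdicCompletionMap (L := L) (IsCMField.complexConj L) hw) ((StdForm.antidiagonal 3).over (w.1.adicCompletion L))))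
    {a : (Gqs L v) →* ((latticeGraph (galAdicCompletionMap (L := L) (IsCMField.complexConj L) hw) ϖ ((StdForm.antidiagonal 3).over (w.1.adicCompletion L))) ≃g (latticeGraph (galAdicCompletionMap (L := L) (IsCMField.complexConj L) hw) ϖ ((StdForm.antidiagonal 3).over (w.1.adicCompletion L))))} (ha : ∀ g, a g = latticeGraphIso (galAdicCompletionMap (L := L) (IsCMField.complexConj L) hw) ϖ ((StdForm.antidiagonal 3).over (w.1.adicCompletion L)) (eA g))
    (x y : {M : Submodule 𝒪[(w.1.adicCompletion L)] (Fin 3 → (w.1.adicCompletion L)) // IsVertex (galAdicCompletionMap (L := L) (IsCMField.complexConj L) hw) ϖ ((StdForm.antidiagonal 3).over (w.1.adicCompletion L)) M}) (hx : IsVertexLattice (galAdicCompletionMap (L := L) (IsCMField.complexConj L) hw) ϖ ((StdForm.antidiagonal 3).over (w.1.adicCompletion L)) 2 x.1) (hy : IsVertexLattice (galAdicCompletionMap (L := L) (IsCMField.complexConj L) hw) ϖ ((StdForm.antidiagonal 3).over (w.1.adicCompletion L)) 2 y.1) : ∃ g : (Gqs L v), a g x = y := by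
  obtain ⟨u, hu⟩ := exists_mapGL_N₁_eq_of_isVertexLattice_two hd hy
  obtain ⟨u₀, hu₀⟩ := exists_mapGL_N₁_eq_of_isVertexLattice_two hd hx
  refine ⟨eA.symm (u * u₀⁻¹), Subtype.ext ?_⟩
  rw [ha, ContinuousMulEquiv.apply_symm_apply, latticeGraphIso_apply_val, hu₀, Subgroup.coe_mul, Subgroup.coe_inv, ← mapGL_mul,
    inv_mul_cancel_right, ← hu]

set_option maxHeartbeats 800000 in
/-- **ONE ORBIT OF EDGES**: `G_v` is transitive on the edges of the (bipartite) tree — every edge is a flag `tail < head` with self-dual head and type-two tail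
(★ `type_of_lt_three`), and ★ E4 `forall_flag_exists_unitary` moves flags. [cite: BruhatTits1972, §10] [cite: SchneiderStuhler1997, §III.4] -/
theorem exists_mapEdgeSet_eq
    (w : PlacesOver L v) (hw : IsCMField.complexConj L • w.1 = w.1) {ϖ : (w.1.adicCompletion L)} (hd : UnramifiedLocalConjDatum (galAdicCompletionMap (L := L) (IsCMField.complexConj L) hw) ϖ)
    (eA : (Gqs L v) ≃ₜ* ↥(unitaryGroupOfForm (galAdicCompletionMap (L := L) (IsCMField.complexConj L) hw) ((StdForm.antidiagonal 3).over (w.1.adicCompletion L))))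
    {a : (Gqs L v) →* ((latticeGraph (galAdicCompletionMap (L := L) (IsCMField.complexConj L) hw) ϖ ((StdForm.antidiagonal 3).over (w.1.adicCompletion L))) ≃g (latticeGraph (galAdicCompletionMap (L := L) (IsCMField.complexConj L) hw) ϖ ((StdForm.antidiagonal 3).over (w.1.adicCompletion L))))} (ha : ∀ g, a g = latticeGraphIso (galAdicCompletionMap (L := L) (IsCMField.complexConj L) hw) ϖ ((StdForm.antidiagonal 3).over (w.1.adicCompletion L)) (eA g))
    (τ : Orientation (latticeGraph (galAdicCompletionMap (L := L) (IsCMField.complexConj L) hw) ϖ ((StdForm.antidiagonal 3).over (w.1.adicCompletion L)))) (hτ : ∀ d, τ.tail d < τ.head d)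
    (d d' : (latticeGraph (galAdicCompletionMap (L := L) (IsCMField.complexConj L) hw) ϖ ((StdForm.antidiagonal 3).over (w.1.adicCompletion L))).edgeSet) : ∃ g : (Gqs L v), (a g).mapEdgeSet d = d' := by
  have hJ : Valued.v (((StdForm.antidiagonal 3).over (w.1.adicCompletion L))).det = 1 := v_det_antidiagonal_three
  have hϖ0 : ϖ ≠ 0 := fun h0 => by
    have hv := hd.vϖ
    rw [h0, map_zero] at hv
    exact WithZero.zero_ne_coe hv
  obtain ⟨g₁, hg₁⟩ : ∃ g₁ : GL (Fin 3) (w.1.adicCompletion L), (g₁ : Matrix (Fin 3) (Fin 3) (w.1.adicCompletion L)) = Matrix.diagonal ![(1 : (w.1.adicCompletion L)), 1, ϖ] := by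
    refine ⟨glDiagonal 3 (w.1.adicCompletion L) ![1, 1, Units.mk0 ϖ hϖ0], ?_⟩
    rw [coe_glDiagonal]
    congr 1
    funext i
    fin_cases i <;> rfl
  have hmapE : ∀ (g : (Gqs L v)) (c : (latticeGraph (galAdicCompletionMap (L := L) (IsCMField.complexConj L) hw) ϖ ((StdForm.antidiagonal 3).over (w.1.adicCompletion L))).edgeSet), (((a g).mapEdgeSet c : (latticeGraph (galAdicCompletionMap (L := L) (IsCMField.complexConj L) hw) ϖ ((StdForm.antidiagonal 3).over (w.1.adicCompletion L))).edgeSet) : Sym2 {M : Submodule 𝒪[(w.1.adicCompletion L)] (Fin 3 → (w.1.adicCompletion L)) // IsVertex (galAdicCompletionMap (L := L) (IsCMField.complexConj L) hw) ϖ ((StdForm.antidiagonal 3).over (w.1.adicCompletion L)) M}) = s(a g (τ.head c), a g (τ.tail c)) := fun g c =>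
    BakerNorine.coe_mapEdgeSet τ (a g) c
  obtain ⟨k₀, hk₀⟩ := (τ.head d).2
  obtain ⟨k₂, hk₂⟩ := (τ.tail d).2
  obtain ⟨hk₂2, hk₀0⟩ := type_of_lt_three hd.vσ hd.vϖ hJ hk₂ hk₀ (Subtype.coe_lt_coe.2 (hτ d))
  subst hk₂2 hk₀0
  obtain ⟨j₀, hj₀⟩ := (τ.head d').2
  obtain ⟨j₂, hj₂⟩ := (τ.tail d').2
  obtain ⟨hj₂2, hj₀0⟩ := type_of_lt_three hd.vσ hd.vϖ hJ hj₂ hj₀ (Subtype.coe_lt_coe.2 (hτ d'))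
  subst hj₂2 hj₀0
  obtain ⟨u, hu, hu'⟩ := forall_flag_exists_unitary hd g₁ hg₁ (τ.head d').1 (τ.tail d').1 hj₀ hj₂ (Subtype.coe_lt_coe.2 (hτ d'))
  obtain ⟨u₁, hu₁, hu₁'⟩ := forall_flag_exists_unitary hd g₁ hg₁ (τ.head d).1 (τ.tail d).1 hk₀ hk₂ (Subtype.coe_lt_coe.2 (hτ d))
  have hh : a (eA.symm (u * u₁⁻¹)) (τ.head d) = τ.head d' := Subtype.ext (by
    rw [ha, ContinuousMulEquiv.apply_symm_apply, latticeGraphIso_apply_val, ← hu₁, Subgroup.coe_mul, Subgroup.coe_inv, ← mapGL_mul,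
      inv_mul_cancel_right, hu])
  have ht : a (eA.symm (u * u₁⁻¹)) (τ.tail d) = τ.tail d' := Subtype.ext (by
    rw [ha, ContinuousMulEquiv.apply_symm_apply, latticeGraphIso_apply_val, ← hu₁', Subgroup.coe_mul, Subgroup.coe_inv, ← mapGL_mul,
      ← mul_assoc, inv_mul_cancel_right, hu'])
  exact ⟨eA.symm (u * u₁⁻¹), Subtype.ext (by rw [hmapE, hh, ht, τ.mk_head_tail])⟩

set_option maxHeartbeats 800000 in
/-- **No inversion: an edge is fixed iff both its ends are** (for the invariant orientation `τ`, ★ `head_mapEdgeSet_latticeGraphIso`). [cite: BruhatTits1972, §10]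
[cite: SchneiderStuhler1997, §III.4] -/
theorem mapEdgeSet_eq_iff
    (w : PlacesOver L v) (hw : IsCMField.complexConj L • w.1 = w.1) {ϖ : (w.1.adicCompletion L)} (eA : (Gqs L v) ≃ₜ* ↥(unitaryGroupOfForm (galAdicCompletionMap (L := L) (IsCMField.complexConj L) hw) ((StdForm.antidiagonal 3).over (w.1.adicCompletion L))))
    {a : (Gqs L v) →* ((latticeGraph (galAdicCompletionMap (L := L) (IsCMField.complexConj L) hw) ϖ ((StdForm.antidiagonal 3).over (w.1.adicCompletion L))) ≃g (latticeGraph (galAdicCompletionMap (L := L) (IsCMField.complexConj L) hw) ϖ ((StdForm.antidiagonal 3).over (w.1.adicCompletion L))))} (ha : ∀ g, a g = latticeGraphIso (galAdicCompletionMap (L := L) (IsCMField.complexConj L) hw) ϖ ((StdForm.antidiagonal 3).over (w.1.adicCompletion L)) (eA g))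
    (τ : Orientation (latticeGraph (galAdicCompletionMap (L := L) (IsCMField.complexConj L) hw) ϖ ((StdForm.antidiagonal 3).over (w.1.adicCompletion L)))) (hτ : ∀ d, τ.tail d < τ.head d)
    (g : (Gqs L v)) (d : (latticeGraph (galAdicCompletionMap (L := L) (IsCMField.complexConj L) hw) ϖ ((StdForm.antidiagonal 3).over (w.1.adicCompletion L))).edgeSet) : (a g).mapEdgeSet d = d ↔ a g (τ.head d) = τ.head d ∧ a g (τ.tail d) = τ.tail d := by
  have hσa : τ.head ((a g).mapEdgeSet d) = a g (τ.head d) ∧ τ.tail ((a g).mapEdgeSet d) = a g (τ.tail d) := by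
    rw [ha]; exact head_mapEdgeSet_latticeGraphIso (galAdicCompletionMap (L := L) (IsCMField.complexConj L) hw) ϖ ((StdForm.antidiagonal 3).over (w.1.adicCompletion L)) hτ (eA g) d
  constructor
  · intro h
    obtain ⟨h1, h2⟩ := hσa
    rw [h] at h1 h2
    exact ⟨h1.symm, h2.symm⟩
  · rintro ⟨h1, h2⟩
    exact Subtype.ext (by rw [BakerNorine.coe_mapEdgeSet τ (a g) d, h1, h2, τ.mk_head_tail])

set_option maxHeartbeats 1600000 in
/-- **THE ORBITAL INTEGRAL OF A `K`-TYPE FUNCTION ON A VERTEX ORBIT**: for a vertex `o` of type `k` (`G_v` transitive on type `k`, hypothesis-style `htrans` — §2 suppliers for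
`k = 0, 2`), its stabiliser `P` (`hP`), `τ₀ = ρ|_P` on `V^{U_o}` trivial on `U_o`, `f = 𝟙_P · χ_{τ₀}(·⁻¹)` (★ row 42 letters), and a regular elliptic `γ`:
`Φ^{can}(γ, f) = ν(P) · Σᶠ_{x ∈ X^γ⁰ of type k} Θ_{U_x}(γ⁻¹)` (★ R48-gen FILE 2 §1 at the datum). [cite: SchneiderStuhler1997, §III.4] [cite: Kottwitz1988, §2]
[cite: Rogawski1990, §4.9 p. 54] -/
theorem classOrbitalIntegral_kType_vertex_eq
    (w : PlacesOver L v) (hw : IsCMField.complexConj L • w.1 = w.1) {ϖ : (w.1.adicCompletion L)} (eA : (Gqs L v) ≃ₜ* ↥(unitaryGroupOfForm (galAdicCompletionMap (L := L) (IsCMField.complexConj L) hw) ((StdForm.antidiagonal 3).over (w.1.adicCompletion L))))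
    {a : (Gqs L v) →* ((latticeGraph (galAdicCompletionMap (L := L) (IsCMField.complexConj L) hw) ϖ ((StdForm.antidiagonal 3).over (w.1.adicCompletion L))) ≃g (latticeGraph (galAdicCompletionMap (L := L) (IsCMField.complexConj L) hw) ϖ ((StdForm.antidiagonal 3).over (w.1.adicCompletion L))))} (ha : ∀ g, a g = latticeGraphIso (galAdicCompletionMap (L := L) (IsCMField.complexConj L) hw) ϖ ((StdForm.antidiagonal 3).over (w.1.adicCompletion L)) (eA g))
    [MeasurableSpace (Gqs L v)] [BorelSpace (Gqs L v)]
    [∀ γ : (Gqs L v), MeasurableSpace ((Gqs L v) ⧸ Subgroup.centralizer ({γ} : Set (Gqs L v)))]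
    [∀ γ : (Gqs L v), BorelSpace ((Gqs L v) ⧸ Subgroup.centralizer ({γ} : Set (Gqs L v)))]
    (νQv : Measure (Gqs L v)) [νQv.IsHaarMeasure] [νQv.IsMulRightInvariant]
    {mQv : OrbitalMeasureFamily (Gqs L v)} (hcanQ : mQv.IsCanonical (fun γ => IsRegularElt (γ.val : GL (Fin 3) (UnitaryGroup.LocalRing L v))) νQv)
    {e : ℕ} {U : {M : Submodule 𝒪[(w.1.adicCompletion L)] (Fin 3 → (w.1.adicCompletion L)) // IsVertex (galAdicCompletionMap (L := L) (IsCMField.complexConj L) hw) ϖ ((StdForm.antidiagonal 3).over (w.1.adicCompletion L)) M} → Subgroup (Gqs L v)}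
    (hU : ∀ x g, g ∈ U x ↔ mapGL ((eA g : ↥(unitaryGroupOfForm (galAdicCompletionMap (L := L) (IsCMField.complexConj L) hw) ((StdForm.antidiagonal 3).over (w.1.adicCompletion L)))) : GL (Fin 3) (w.1.adicCompletion L)) x.1 = x.1 ∧
      x.1.map ((Matrix.toLin' ((((eA g : ↥(unitaryGroupOfForm (galAdicCompletionMap (L := L) (IsCMField.complexConj L) hw) ((StdForm.antidiagonal 3).over (w.1.adicCompletion L)))) : GL (Fin 3) (w.1.adicCompletion L)) : Matrix (Fin 3) (Fin 3) (w.1.adicCompletion L)) - 1)).restrictScalars 𝒪[(w.1.adicCompletion L)]) ≤ scaleLattice (ϖ ^ (e + 1)) x.1)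
    (hUo : ∀ x, IsOpen (U x : Set (Gqs L v))) (hUc : ∀ x, IsCompact (U x : Set (Gqs L v)))
    {k : ℕ} (htrans : ∀ x y : {M : Submodule 𝒪[(w.1.adicCompletion L)] (Fin 3 → (w.1.adicCompletion L)) // IsVertex (galAdicCompletionMap (L := L) (IsCMField.complexConj L) hw) ϖ ((StdForm.antidiagonal 3).over (w.1.adicCompletion L)) M}, IsVertexLattice (galAdicCompletionMap (L := L) (IsCMField.complexConj L) hw) ϖ ((StdForm.antidiagonal 3).over (w.1.adicCompletion L)) k x.1 → IsVertexLattice (galAdicCompletionMap (L := L) (IsCMField.complexConj L) hw) ϖ ((StdForm.antidiagonal 3).over (w.1.adicCompletion L)) k y.1 → ∃ g : (Gqs L v), a g x = y)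
    (o : {M : Submodule 𝒪[(w.1.adicCompletion L)] (Fin 3 → (w.1.adicCompletion L)) // IsVertex (galAdicCompletionMap (L := L) (IsCMField.complexConj L) hw) ϖ ((StdForm.antidiagonal 3).over (w.1.adicCompletion L)) M}) (ho : IsVertexLattice (galAdicCompletionMap (L := L) (IsCMField.complexConj L) hw) ϖ ((StdForm.antidiagonal 3).over (w.1.adicCompletion L)) k o.1) (P : Subgroup (Gqs L v)) (hP : ∀ g, g ∈ P ↔ a g o = o)
    {V : Type*} [AddCommGroup V] [Module ℂ V] (ρ : Representation ℂ (Gqs L v) V) [FiniteDimensional ℂ ↥(ρ.fixedPoints (U o))]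
    (τ₀ : Representation ℂ ↥P ↥(ρ.fixedPoints (U o)))
    (hτρ₀ : ∀ (p : ↥P) (x : ↥(ρ.fixedPoints (U o))), ((τ₀ p x : ↥(ρ.fixedPoints (U o))) : V) = ρ (p : (Gqs L v)) (x : V))
    (hτ₀ : ∀ p : ↥P, (p : (Gqs L v)) ∈ U o → τ₀ p = 1)
    {f : (Gqs L v) → ℂ} (hfP : ∀ (g : (Gqs L v)) (hg : g ∈ P), f g = Representation.character τ₀ ⟨g, hg⟩⁻¹) (hf0 : ∀ g ∉ P, f g = 0)
    {γ : (Gqs L v)} (hreg : IsRegularElt (γ.val : GL (Fin 3) (UnitaryGroup.LocalRing L v)))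
    (hell : IsCompact ((Subgroup.centralizer ({γ} : Set (Gqs L v))) : Set (Gqs L v))) :
    classOrbitalIntegral mQv f (ConjClasses.mk γ) =
      νQv.real (P : Set (Gqs L v)) • ∑ᶠ x ∈ {x : {M : Submodule 𝒪[(w.1.adicCompletion L)] (Fin 3 → (w.1.adicCompletion L)) // IsVertex (galAdicCompletionMap (L := L) (IsCMField.complexConj L) hw) ϖ ((StdForm.antidiagonal 3).over (w.1.adicCompletion L)) M} | a γ x = x ∧ IsVertexLattice (galAdicCompletionMap (L := L) (IsCMField.complexConj L) hw) ϖ ((StdForm.antidiagonal 3).over (w.1.adicCompletion L)) k x.1}, ρ.levelTrace (hUo x) (hUc x) γ⁻¹ := by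
  have hHf : ((qsForm L).map (cmConjRingHom L))ᵀ = qsForm L := UnitaryGroup.antidiagOne_isHermitian L 3
  have hdetf : (qsForm L).det ≠ 0 := (UnitaryGroup.isUnit_antidiagOne_det L 3).ne_zero
  have hQ : ∀ g x : (Gqs L v), IsRegularElt (g.val : GL (Fin 3) (UnitaryGroup.LocalRing L v)) →
      IsRegularElt ((x * g * x⁻¹ : (Gqs L v)).val : GL (Fin 3) (UnitaryGroup.LocalRing L v)) := fun g x hg => UnitaryGroup.isRegularElt_val_conj L 3 (qsForm L) v g x hg
  haveI : CompactSpace (Subgroup.centralizer ({γ} : Set (Gqs L v))) := isCompact_iff_compactSpace.1 hell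
  have hO : IsClosed {x : (Gqs L v) | ∃ y : (Gqs L v), y * γ * y⁻¹ = x} := UnitaryGroup.isClosed_conjClass_local_of_isRegularElt L 3 (qsForm L) v hHf hdetf γ hreg
  -- the stabiliser is compact open
  have hPset : (P : Set (Gqs L v)) = {g | a g o = o} := Set.ext hP
  have hPo : IsOpen (P : Set (Gqs L v)) := by rw [hPset]; exact isOpen_setOf_actionHom_apply_eq ha o
  have hPc : IsCompact (P : Set (Gqs L v)) := by rw [hPset]; exact isCompact_setOf_actionHom_apply_eq L v w hw eA ha o
  -- the orbit as a `G_v`-set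
  obtain ⟨act, hact⟩ : ∃ act : (Gqs L v) → {x : {M : Submodule 𝒪[(w.1.adicCompletion L)] (Fin 3 → (w.1.adicCompletion L)) // IsVertex (galAdicCompletionMap (L := L) (IsCMField.complexConj L) hw) ϖ ((StdForm.antidiagonal 3).over (w.1.adicCompletion L)) M} // IsVertexLattice (galAdicCompletionMap (L := L) (IsCMField.complexConj L) hw) ϖ ((StdForm.antidiagonal 3).over (w.1.adicCompletion L)) k x.1} → {x : {M : Submodule 𝒪[(w.1.adicCompletion L)] (Fin 3 → (w.1.adicCompletion L)) // IsVertex (galAdicCompletionMap (L := L) (IsCMField.complexConj L) hw) ϖ ((StdForm.antidiagonal 3).over (w.1.adicCompletion L)) M} // IsVertexLattice (galAdicCompletionMap (L := L) (IsCMField.complexConj L) hw) ϖ ((StdForm.antidiagonal 3).over (w.1.adicCompletion L)) k x.1},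
      ∀ g x, ((act g x : {x : {M : Submodule 𝒪[(w.1.adicCompletion L)] (Fin 3 → (w.1.adicCompletion L)) // IsVertex (galAdicCompletionMap (L := L) (IsCMField.complexConj L) hw) ϖ ((StdForm.antidiagonal 3).over (w.1.adicCompletion L)) M} // IsVertexLattice (galAdicCompletionMap (L := L) (IsCMField.complexConj L) hw) ϖ ((StdForm.antidiagonal 3).over (w.1.adicCompletion L)) k x.1}) : {M : Submodule 𝒪[(w.1.adicCompletion L)] (Fin 3 → (w.1.adicCompletion L)) // IsVertex (galAdicCompletionMap (L := L) (IsCMField.complexConj L) hw) ϖ ((StdForm.antidiagonal 3).over (w.1.adicCompletion L)) M}) = a g x.1 := by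
    refine ⟨fun g x => ⟨a g x.1, ?_⟩, fun _ _ => rfl⟩
    rw [ha, latticeGraphIso_apply_val]
    exact (isVertexLattice_mapGL_iff (σ := (galAdicCompletionMap (L := L) (IsCMField.complexConj L) hw)) (ϖ := ϖ) (H := ((StdForm.antidiagonal 3).over (w.1.adicCompletion L))) (eA g) x.1.1).2 x.2
  have hact_one : ∀ x, act 1 x = x := fun x => Subtype.ext (by rw [hact, map_one, RelIso.coe_one, id_eq])
  have hact_mul : ∀ (g h : (Gqs L v)) (x), act (g * h) x = act g (act h x) := fun g h x =>
    Subtype.ext (by rw [hact, hact, hact, map_mul, RelIso.coe_mul, Function.comp_apply])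
  have hV : ∀ x : {x : {M : Submodule 𝒪[(w.1.adicCompletion L)] (Fin 3 → (w.1.adicCompletion L)) // IsVertex (galAdicCompletionMap (L := L) (IsCMField.complexConj L) hw) ϖ ((StdForm.antidiagonal 3).over (w.1.adicCompletion L)) M} // IsVertexLattice (galAdicCompletionMap (L := L) (IsCMField.complexConj L) hw) ϖ ((StdForm.antidiagonal 3).over (w.1.adicCompletion L)) k x.1}, ∃ g : (Gqs L v), act g ⟨o, ho⟩ = x := fun x => by
    obtain ⟨g, hg⟩ := htrans o x.1 ho x.2
    exact ⟨g, Subtype.ext ((hact g ⟨o, ho⟩).trans hg)⟩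
  have hP' : ∀ g, g ∈ P ↔ act g ⟨o, ho⟩ = ⟨o, ho⟩ := fun g =>
    (hP g).trans ⟨fun h => Subtype.ext ((hact g ⟨o, ho⟩).trans h), fun h => (hact g ⟨o, ho⟩).symm.trans (congrArg Subtype.val h)⟩
  have hUg : ∀ (g : (Gqs L v)) (x : {x : {M : Submodule 𝒪[(w.1.adicCompletion L)] (Fin 3 → (w.1.adicCompletion L)) // IsVertex (galAdicCompletionMap (L := L) (IsCMField.complexConj L) hw) ϖ ((StdForm.antidiagonal 3).over (w.1.adicCompletion L)) M} // IsVertexLattice (galAdicCompletionMap (L := L) (IsCMField.complexConj L) hw) ϖ ((StdForm.antidiagonal 3).over (w.1.adicCompletion L)) k x.1}), U (act g x).1 = (U x.1).map (MulAut.conj g).toMonoidHom := fun g x => by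
    rw [hact]; exact unitaryLevel_gqs_actionHom_eq_map_conj ha hU g x.1
  have hUP : U o ≤ P := fun u hu => (hP u).2 (actionHom_apply_eq_of_mem ha hU hu)
  have hPU : P ≤ Subgroup.normalizer (U o : Set (Gqs L v)) := fun g hg => mem_normalizer_unitaryLevel_gqs_of_apply_eq ha hU ((hP g).1 hg)
  have h := classOrbitalIntegral_kType_eq_smul_finsum_levelTrace ρ act hact_one hact_mul hQ hcanQ hreg hO hV P hP' hPo hPc (fun x => U x.1)
    (fun x => hUo x.1) (fun x => hUc x.1) hUg hUP hPU τ₀ hτρ₀ (fun u hu => hτ₀ ⟨u, hUP hu⟩ hu) hfP hf0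
  beta_reduce at h
  have hfix : ∀ x : {x : {M : Submodule 𝒪[(w.1.adicCompletion L)] (Fin 3 → (w.1.adicCompletion L)) // IsVertex (galAdicCompletionMap (L := L) (IsCMField.complexConj L) hw) ϖ ((StdForm.antidiagonal 3).over (w.1.adicCompletion L)) M} // IsVertexLattice (galAdicCompletionMap (L := L) (IsCMField.complexConj L) hw) ϖ ((StdForm.antidiagonal 3).over (w.1.adicCompletion L)) k x.1}, act γ x = x ↔ a γ x.1 = x.1 := fun x =>
    ⟨fun h => (hact γ x).symm.trans (congrArg Subtype.val h), fun h => Subtype.ext ((hact γ x).trans h)⟩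
  have hmaps : Set.MapsTo Subtype.val {x : {x : {M : Submodule 𝒪[(w.1.adicCompletion L)] (Fin 3 → (w.1.adicCompletion L)) // IsVertex (galAdicCompletionMap (L := L) (IsCMField.complexConj L) hw) ϖ ((StdForm.antidiagonal 3).over (w.1.adicCompletion L)) M} // IsVertexLattice (galAdicCompletionMap (L := L) (IsCMField.complexConj L) hw) ϖ ((StdForm.antidiagonal 3).over (w.1.adicCompletion L)) k x.1} | act γ x = x} {x : {M : Submodule 𝒪[(w.1.adicCompletion L)] (Fin 3 → (w.1.adicCompletion L)) // IsVertex (galAdicCompletionMap (L := L) (IsCMField.complexConj L) hw) ϖ ((StdForm.antidiagonal 3).over (w.1.adicCompletion L)) M} | a γ x = x ∧ IsVertexLattice (galAdicCompletionMap (L := L) (IsCMField.complexConj L) hw) ϖ ((StdForm.antidiagonal 3).over (w.1.adicCompletion L)) k x.1} :=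
    fun x hx => ⟨(hfix x).1 hx, x.2⟩
  have hsurj : Set.SurjOn Subtype.val {x : {x : {M : Submodule 𝒪[(w.1.adicCompletion L)] (Fin 3 → (w.1.adicCompletion L)) // IsVertex (galAdicCompletionMap (L := L) (IsCMField.complexConj L) hw) ϖ ((StdForm.antidiagonal 3).over (w.1.adicCompletion L)) M} // IsVertexLattice (galAdicCompletionMap (L := L) (IsCMField.complexConj L) hw) ϖ ((StdForm.antidiagonal 3).over (w.1.adicCompletion L)) k x.1} | act γ x = x} {x : {M : Submodule 𝒪[(w.1.adicCompletion L)] (Fin 3 → (w.1.adicCompletion L)) // IsVertex (galAdicCompletionMap (L := L) (IsCMField.complexConj L) hw) ϖ ((StdForm.antidiagonal 3).over (w.1.adicCompletion L)) M} | a γ x = x ∧ IsVertexLattice (galAdicCompletionMap (L := L) (IsCMField.complexConj L) hw) ϖ ((StdForm.antidiagonal 3).over (w.1.adicCompletion L)) k x.1} :=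
    fun y hy => ⟨⟨y, hy.2⟩, (hfix ⟨y, hy.2⟩).2 hy.1, rfl⟩
  have hF : ∑ᶠ x ∈ {x : {x : {M : Submodule 𝒪[(w.1.adicCompletion L)] (Fin 3 → (w.1.adicCompletion L)) // IsVertex (galAdicCompletionMap (L := L) (IsCMField.complexConj L) hw) ϖ ((StdForm.antidiagonal 3).over (w.1.adicCompletion L)) M} // IsVertexLattice (galAdicCompletionMap (L := L) (IsCMField.complexConj L) hw) ϖ ((StdForm.antidiagonal 3).over (w.1.adicCompletion L)) k x.1} | act γ x = x}, ρ.levelTrace (hUo x.1) (hUc x.1) γ⁻¹ =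
      ∑ᶠ x ∈ {x : {M : Submodule 𝒪[(w.1.adicCompletion L)] (Fin 3 → (w.1.adicCompletion L)) // IsVertex (galAdicCompletionMap (L := L) (IsCMField.complexConj L) hw) ϖ ((StdForm.antidiagonal 3).over (w.1.adicCompletion L)) M} | a γ x = x ∧ IsVertexLattice (galAdicCompletionMap (L := L) (IsCMField.complexConj L) hw) ϖ ((StdForm.antidiagonal 3).over (w.1.adicCompletion L)) k x.1}, ρ.levelTrace (hUo x) (hUc x) γ⁻¹ :=
    finsum_mem_eq_of_bijOn (f := fun x : {x : {M : Submodule 𝒪[(w.1.adicCompletion L)] (Fin 3 → (w.1.adicCompletion L)) // IsVertex (galAdicCompletionMap (L := L) (IsCMField.complexConj L) hw) ϖ ((StdForm.antidiagonal 3).over (w.1.adicCompletion L)) M} // IsVertexLattice (galAdicCompletionMap (L := L) (IsCMField.complexConj L) hw) ϖ ((StdForm.antidiagonal 3).over (w.1.adicCompletion L)) k x.1} => ρ.levelTrace (hUo x.1) (hUc x.1) γ⁻¹)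
      (g := fun x : {M : Submodule 𝒪[(w.1.adicCompletion L)] (Fin 3 → (w.1.adicCompletion L)) // IsVertex (galAdicCompletionMap (L := L) (IsCMField.complexConj L) hw) ϖ ((StdForm.antidiagonal 3).over (w.1.adicCompletion L)) M} => ρ.levelTrace (hUo x) (hUc x) γ⁻¹) Subtype.val ⟨hmaps, Subtype.val_injective.injOn, hsurj⟩ (fun _ _ => rfl)
  rw [h, hF]

set_option maxHeartbeats 1600000 in
/-- **THE ORBITAL INTEGRAL OF A `K`-TYPE FUNCTION ON THE EDGE ORBIT**: for the base edge `d₁` with stabiliser `P₁` (`hP₁`), `τ₁ = ρ|_{P₁}` on `V^{U_{d₁}}`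
(`U_d = U (τ.head d) ⊔ U (τ.tail d)`) trivial on `U_{d₁}`, `f = 𝟙_{P₁} · χ_{τ₁}(·⁻¹)`, and a regular elliptic `γ`:
`Φ^{can}(γ, f) = ν(P₁) · Σᶠ_{d ∈ X^γ¹} Θ_{U_d}(γ⁻¹)` (★ R48-gen FILE 2 §1 on the edge orbit; no inversion: a fixed edge has fixed ends).
[cite: SchneiderStuhler1997, §III.4] [cite: Kottwitz1988, §2] [cite: Rogawski1990, §4.9 p. 54] -/
theorem classOrbitalIntegral_kType_edge_eq
    (w : PlacesOver L v) (hw : IsCMField.complexConj L • w.1 = w.1) {ϖ : (w.1.adicCompletion L)} (hd : UnramifiedLocalConjDatum (galAdicCompletionMap (L := L) (IsCMField.complexConj L) hw) ϖ)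
    (eA : (Gqs L v) ≃ₜ* ↥(unitaryGroupOfForm (galAdicCompletionMap (L := L) (IsCMField.complexConj L) hw) ((StdForm.antidiagonal 3).over (w.1.adicCompletion L))))
    {a : (Gqs L v) →* ((latticeGraph (galAdicCompletionMap (L := L) (IsCMField.complexConj L) hw) ϖ ((StdForm.antidiagonal 3).over (w.1.adicCompletion L))) ≃g (latticeGraph (galAdicCompletionMap (L := L) (IsCMField.complexConj L) hw) ϖ ((StdForm.antidiagonal 3).over (w.1.adicCompletion L))))} (ha : ∀ g, a g = latticeGraphIso (galAdicCompletionMap (L := L) (IsCMField.complexConj L) hw) ϖ ((StdForm.antidiagonal 3).over (w.1.adicCompletion L)) (eA g))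
    [MeasurableSpace (Gqs L v)] [BorelSpace (Gqs L v)]
    [∀ γ : (Gqs L v), MeasurableSpace ((Gqs L v) ⧸ Subgroup.centralizer ({γ} : Set (Gqs L v)))]
    [∀ γ : (Gqs L v), BorelSpace ((Gqs L v) ⧸ Subgroup.centralizer ({γ} : Set (Gqs L v)))]
    (νQv : Measure (Gqs L v)) [νQv.IsHaarMeasure] [νQv.IsMulRightInvariant]
    {mQv : OrbitalMeasureFamily (Gqs L v)} (hcanQ : mQv.IsCanonical (fun γ => IsRegularElt (γ.val : GL (Fin 3) (UnitaryGroup.LocalRing L v))) νQv)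
    (τ : Orientation (latticeGraph (galAdicCompletionMap (L := L) (IsCMField.complexConj L) hw) ϖ ((StdForm.antidiagonal 3).over (w.1.adicCompletion L)))) (hτ : ∀ d, τ.tail d < τ.head d)
    {e : ℕ} {U : {M : Submodule 𝒪[(w.1.adicCompletion L)] (Fin 3 → (w.1.adicCompletion L)) // IsVertex (galAdicCompletionMap (L := L) (IsCMField.complexConj L) hw) ϖ ((StdForm.antidiagonal 3).over (w.1.adicCompletion L)) M} → Subgroup (Gqs L v)}
    (hU : ∀ x g, g ∈ U x ↔ mapGL ((eA g : ↥(unitaryGroupOfForm (galAdicCompletionMap (L := L) (IsCMField.complexConj L) hw) ((StdForm.antidiagonal 3).over (w.1.adicCompletion L)))) : GL (Fin 3) (w.1.adicCompletion L)) x.1 = x.1 ∧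
      x.1.map ((Matrix.toLin' ((((eA g : ↥(unitaryGroupOfForm (galAdicCompletionMap (L := L) (IsCMField.complexConj L) hw) ((StdForm.antidiagonal 3).over (w.1.adicCompletion L)))) : GL (Fin 3) (w.1.adicCompletion L)) : Matrix (Fin 3) (Fin 3) (w.1.adicCompletion L)) - 1)).restrictScalars 𝒪[(w.1.adicCompletion L)]) ≤ scaleLattice (ϖ ^ (e + 1)) x.1)
    (hEo : ∀ d : (latticeGraph (galAdicCompletionMap (L := L) (IsCMField.complexConj L) hw) ϖ ((StdForm.antidiagonal 3).over (w.1.adicCompletion L))).edgeSet, IsOpen ((U (τ.head d) ⊔ U (τ.tail d) : Subgroup (Gqs L v)) : Set (Gqs L v)))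
    (hEc : ∀ d : (latticeGraph (galAdicCompletionMap (L := L) (IsCMField.complexConj L) hw) ϖ ((StdForm.antidiagonal 3).over (w.1.adicCompletion L))).edgeSet, IsCompact ((U (τ.head d) ⊔ U (τ.tail d) : Subgroup (Gqs L v)) : Set (Gqs L v)))
    (d₁ : (latticeGraph (galAdicCompletionMap (L := L) (IsCMField.complexConj L) hw) ϖ ((StdForm.antidiagonal 3).over (w.1.adicCompletion L))).edgeSet) (P₁ : Subgroup (Gqs L v)) (hP₁ : ∀ g, g ∈ P₁ ↔ (a g).mapEdgeSet d₁ = d₁)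
    {V : Type*} [AddCommGroup V] [Module ℂ V] (ρ : Representation ℂ (Gqs L v) V) [FiniteDimensional ℂ ↥(ρ.fixedPoints (U (τ.head d₁) ⊔ U (τ.tail d₁)))]
    (τ₁ : Representation ℂ ↥P₁ ↥(ρ.fixedPoints (U (τ.head d₁) ⊔ U (τ.tail d₁))))
    (hτρ₁ : ∀ (p : ↥P₁) (x : ↥(ρ.fixedPoints (U (τ.head d₁) ⊔ U (τ.tail d₁)))), ((τ₁ p x : ↥(ρ.fixedPoints (U (τ.head d₁) ⊔ U (τ.tail d₁)))) : V) = ρ (p : (Gqs L v)) (x : V))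
    (hτ₁ : ∀ p : ↥P₁, (p : (Gqs L v)) ∈ U (τ.head d₁) ⊔ U (τ.tail d₁) → τ₁ p = 1)
    {f : (Gqs L v) → ℂ} (hfP : ∀ (g : (Gqs L v)) (hg : g ∈ P₁), f g = Representation.character τ₁ ⟨g, hg⟩⁻¹) (hf0 : ∀ g ∉ P₁, f g = 0)
    {γ : (Gqs L v)} (hreg : IsRegularElt (γ.val : GL (Fin 3) (UnitaryGroup.LocalRing L v)))
    (hell : IsCompact ((Subgroup.centralizer ({γ} : Set (Gqs L v))) : Set (Gqs L v))) :
    classOrbitalIntegral mQv f (ConjClasses.mk γ) =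
      νQv.real (P₁ : Set (Gqs L v)) • ∑ᶠ d ∈ {d : (latticeGraph (galAdicCompletionMap (L := L) (IsCMField.complexConj L) hw) ϖ ((StdForm.antidiagonal 3).over (w.1.adicCompletion L))).edgeSet | (a γ).mapEdgeSet d = d}, ρ.levelTrace (hEo d) (hEc d) γ⁻¹ := by
  have hHf : ((qsForm L).map (cmConjRingHom L))ᵀ = qsForm L := UnitaryGroup.antidiagOne_isHermitian L 3
  have hdetf : (qsForm L).det ≠ 0 := (UnitaryGroup.isUnit_antidiagOne_det L 3).ne_zero
  have hQ : ∀ g x : (Gqs L v), IsRegularElt (g.val : GL (Fin 3) (UnitaryGroup.LocalRing L v)) →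
      IsRegularElt ((x * g * x⁻¹ : (Gqs L v)).val : GL (Fin 3) (UnitaryGroup.LocalRing L v)) := fun g x hg => UnitaryGroup.isRegularElt_val_conj L 3 (qsForm L) v g x hg
  haveI : CompactSpace (Subgroup.centralizer ({γ} : Set (Gqs L v))) := isCompact_iff_compactSpace.1 hell
  have hO : IsClosed {x : (Gqs L v) | ∃ y : (Gqs L v), y * γ * y⁻¹ = x} := UnitaryGroup.isClosed_conjClass_local_of_isRegularElt L 3 (qsForm L) v hHf hdetf γ hreg
  -- orientation transport and «a fixed edge has fixed ends»
  have hσa : ∀ (g : (Gqs L v)) (d : (latticeGraph (galAdicCompletionMap (L := L) (IsCMField.complexConj L) hw) ϖ ((StdForm.antidiagonal 3).over (w.1.adicCompletion L))).edgeSet), τ.head ((a g).mapEdgeSet d) = a g (τ.head d) ∧ τ.tail ((a g).mapEdgeSet d) = a g (τ.tail d) := fun g d => by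
    rw [ha]; exact head_mapEdgeSet_latticeGraphIso (galAdicCompletionMap (L := L) (IsCMField.complexConj L) hw) ϖ ((StdForm.antidiagonal 3).over (w.1.adicCompletion L)) hτ (eA g) d
  have hfixE : ∀ (g : (Gqs L v)) (d : (latticeGraph (galAdicCompletionMap (L := L) (IsCMField.complexConj L) hw) ϖ ((StdForm.antidiagonal 3).over (w.1.adicCompletion L))).edgeSet), (a g).mapEdgeSet d = d ↔ a g (τ.head d) = τ.head d ∧ a g (τ.tail d) = τ.tail d :=
    mapEdgeSet_eq_iff L v w hw eA ha τ hτ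
  have hadj₁ : (latticeGraph (galAdicCompletionMap (L := L) (IsCMField.complexConj L) hw) ϖ ((StdForm.antidiagonal 3).over (w.1.adicCompletion L))).Adj (τ.head d₁) (τ.tail d₁) := τ.adj_head_tail d₁
  -- `U_{d₁} ≤ P₁ ≤ N(U_{d₁})`, `P₁` compact open
  have hUP : U (τ.head d₁) ⊔ U (τ.tail d₁) ≤ P₁ :=
    sup_le (fun u hu => (hP₁ u).2 ((hfixE u d₁).2 ⟨actionHom_apply_eq_of_mem ha hU hu, actionHom_apply_eq_of_mem_of_adj ha hU hd hu hadj₁⟩))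
      (fun u hu => (hP₁ u).2 ((hfixE u d₁).2 ⟨actionHom_apply_eq_of_mem_of_adj ha hU hd hu hadj₁.symm, actionHom_apply_eq_of_mem ha hU hu⟩))
  have hPU : P₁ ≤ Subgroup.normalizer ((U (τ.head d₁) ⊔ U (τ.tail d₁) : Subgroup (Gqs L v)) : Set (Gqs L v)) := fun g hg =>
    mem_normalizer_sup_of_mem (mem_normalizer_unitaryLevel_gqs_of_apply_eq ha hU ((hfixE g d₁).1 ((hP₁ g).1 hg)).1)
      (mem_normalizer_unitaryLevel_gqs_of_apply_eq ha hU ((hfixE g d₁).1 ((hP₁ g).1 hg)).2)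
  have hPo : IsOpen (P₁ : Set (Gqs L v)) := Subgroup.isOpen_mono hUP (hEo d₁)
  have hPc : IsCompact (P₁ : Set (Gqs L v)) :=
    (isCompact_setOf_actionHom_apply_eq L v w hw eA ha (τ.head d₁)).of_isClosed_subset (Subgroup.isClosed_of_isOpen P₁ hPo)
      fun g hg => ((hfixE g d₁).1 ((hP₁ g).1 hg)).1
  -- the edge orbit as a `G_v`-set
  have hE1 : ∀ d : (latticeGraph (galAdicCompletionMap (L := L) (IsCMField.complexConj L) hw) ϖ ((StdForm.antidiagonal 3).over (w.1.adicCompletion L))).edgeSet, (fun (g : (Gqs L v)) (d : (latticeGraph (galAdicCompletionMap (L := L) (IsCMField.complexConj L) hw) ϖ ((StdForm.antidiagonal 3).over (w.1.adicCompletion L))).edgeSet) => (a g).mapEdgeSet d) 1 d = d := fun d => by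
    beta_reduce
    rw [map_one, BakerNorine.mapEdgeSet_one]
  have hEmul : ∀ (g h : (Gqs L v)) (d : (latticeGraph (galAdicCompletionMap (L := L) (IsCMField.complexConj L) hw) ϖ ((StdForm.antidiagonal 3).over (w.1.adicCompletion L))).edgeSet),
      (fun (g : (Gqs L v)) (d : (latticeGraph (galAdicCompletionMap (L := L) (IsCMField.complexConj L) hw) ϖ ((StdForm.antidiagonal 3).over (w.1.adicCompletion L))).edgeSet) => (a g).mapEdgeSet d) (g * h) d =
        (fun (g : (Gqs L v)) (d : (latticeGraph (galAdicCompletionMap (L := L) (IsCMField.complexConj L) hw) ϖ ((StdForm.antidiagonal 3).over (w.1.adicCompletion L))).edgeSet) => (a g).mapEdgeSet d) g ((fun (g : (Gqs L v)) (d : (latticeGraph (galAdicCompletionMap (L := L) (IsCMField.complexConj L) hw) ϖ ((StdForm.antidiagonal 3).over (w.1.adicCompletion L))).edgeSet) => (a g).mapEdgeSet d) h d) := fun g h d => by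
    beta_reduce
    rw [map_mul, BakerNorine.mapEdgeSet_mul]
  have hV : ∀ d : (latticeGraph (galAdicCompletionMap (L := L) (IsCMField.complexConj L) hw) ϖ ((StdForm.antidiagonal 3).over (w.1.adicCompletion L))).edgeSet, ∃ g : (Gqs L v), (fun (g : (Gqs L v)) (d : (latticeGraph (galAdicCompletionMap (L := L) (IsCMField.complexConj L) hw) ϖ ((StdForm.antidiagonal 3).over (w.1.adicCompletion L))).edgeSet) => (a g).mapEdgeSet d) g d₁ = d := fun d =>
    exists_mapEdgeSet_eq L v w hw hd eA ha τ hτ d₁ d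
  have hUg : ∀ (g : (Gqs L v)) (d : (latticeGraph (galAdicCompletionMap (L := L) (IsCMField.complexConj L) hw) ϖ ((StdForm.antidiagonal 3).over (w.1.adicCompletion L))).edgeSet),
      U (τ.head ((fun (g : (Gqs L v)) (d : (latticeGraph (galAdicCompletionMap (L := L) (IsCMField.complexConj L) hw) ϖ ((StdForm.antidiagonal 3).over (w.1.adicCompletion L))).edgeSet) => (a g).mapEdgeSet d) g d)) ⊔ U (τ.tail ((fun (g : (Gqs L v)) (d : (latticeGraph (galAdicCompletionMap (L := L) (IsCMField.complexConj L) hw) ϖ ((StdForm.antidiagonal 3).over (w.1.adicCompletion L))).edgeSet) => (a g).mapEdgeSet d) g d)) =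
        (U (τ.head d) ⊔ U (τ.tail d)).map (MulAut.conj g).toMonoidHom := fun g d => by
    beta_reduce
    obtain ⟨h1, h2⟩ := hσa g d
    rw [h1, h2, Subgroup.map_sup, unitaryLevel_gqs_actionHom_eq_map_conj ha hU g (τ.head d), unitaryLevel_gqs_actionHom_eq_map_conj ha hU g (τ.tail d)]
  have h := classOrbitalIntegral_kType_eq_smul_finsum_levelTrace ρ (fun (g : (Gqs L v)) (d : (latticeGraph (galAdicCompletionMap (L := L) (IsCMField.complexConj L) hw) ϖ ((StdForm.antidiagonal 3).over (w.1.adicCompletion L))).edgeSet) => (a g).mapEdgeSet d) hE1 hEmul hQ hcanQ hreg hO hV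
    P₁ hP₁ hPo hPc (fun d => U (τ.head d) ⊔ U (τ.tail d)) hEo hEc hUg hUP hPU τ₁ hτρ₁ (fun u hu => hτ₁ ⟨u, hUP hu⟩ hu) hfP hf0
  beta_reduce at h
  exact h


end Head

end Summit.HodgeConjecture.HodgeConjecture.Cruxes.H413.F0P3cStCharTSEPFunctionOrbitalOrbits

end
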